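import Summits.BirchSwinnertonDyer.BirchSwinnertonDyer.Theorems.AlignedTransportAtTwoMainConjectureOfRankZeroBSDAtTwoHalfDescentBaseIndexLayerNumbers
import Literature.NumberTheory.EllipticCurves.BSDQuadraticDescentShaOddPartProofs
import Mathlib.GroupTheory.PGroup
import HarnessLib

/-!
# Route `AlignedTransportAtTwo`, crux C2 `MainConjectureOfRankZeroBSDAtTwo` (stmt-BirchSwinnertonDyer-22298):
# THE BASE TERM CARRIES `p^μ`, XVI — THE DATA HYPOTHESIS `#Sel = p^s` REMOVED: a finite `p^∞`-Selmer group has `p`-power order (it is `p`-primary torsion), so files XIII–XIV hold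
# for EVERY seed with `Sel_{2^∞}(W/ℚ)` finite: no finite submodule, `#ker g_0 = 2^{ord₂ Tam(W) + 2·ord₂ #W̃(𝔽₂)}`, `#Sel_{2^∞}(W/ℚ_∞)^Γ = 2^{ord₂ Tam + 2·ord₂ #W̃(𝔽₂)}·#Sel_{2^∞}(W/ℚ)`,
# and the exact one-layer door `μ₂ = 0 ⟺ #Sel_{n+1}·#ker g_{n+1} < 2^{2ⁿ}·#Sel_n·#ker g_n` (`λ₂ < 2ⁿ`) — DATUM-FREE numbers on the right

HONEST FRAMING (cell `bsd-f1-sign2`, WIDTH-5 attached prover seat `bsd-line-att-p5` gen 61 on line `birth` of the lead `bsd-line-att-p2`;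
`--supports` stmt-BirchSwinnertonDyer-22298, closes nothing; BSD is NOT proved by any of this; the crux C2, its verdict «blocked-on
`Rank1Residual.GreenbergMuConjectureIrreducible`» and every registered stub (P / T / Kμ / LimDoor / MuIneqʳ / PFμ⁺) are untouched). THEOREMS ONLY — no `def`,
no instance, no named fact, no `sorry`; print-free. Files XIII (`…BaseIndexNoFinite`) and XIV (`…BaseIndexLayerNumbers`) took the exponent `s` with `#Sel_{p^∞}(W/ℚ) = p^s` as
data (the lineage's convention since gen 38); the tree's `exists_pow_nsmul_eq_zero_selmerGroupPInfty` (every Selmer class is killed by a power of `p`) and Mathlib's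
`IsPGroup.iff_card` supply it, so the statements below carry only `Finite (W.selmerGroupPInfty p)`.

* §1 ★ `exists_natCard_selmerGroupPInfty_eq_pow`: **`#Sel_{p^∞}(W/F) = p^s` for some `s`** whenever it is finite (ANY number field `F : Type`, any `p`).
* §2 (`ℚ`, good ordinary `p`, `#W̃(𝔽_p) = p^k` pure, `W(ℚ)[p] = 0`, `Sel_{p^∞}(W/ℚ)` finite) ★★★ `forall_finite_submodule_eq_bot_of_pure'`, ★★ `natCard_kerG_zero_eq_pow_of_pure'`,
  ★★ `natCard_selmerInvariants_zero_eq_mul_of_pure'` (`#Sel_∞^Γ = p^{v+2k}·#Sel_{p^∞}(W/ℚ)`).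
* §3 (`p = 2`, THE SEED CELL: good ordinary at `2`, no rational `2`-torsion abscissa, `Sel_{2^∞}(W/ℚ)` finite, ANY dual datum) ★★★ `forall_finite_submodule_eq_bot_seed'`:
  **`X(W/ℚ_∞)` has no non-zero finite `Λ`-submodule** (Greenberg Prop. 4.14 at `p = 2` on the rank-`0` good-ordinary locus, hypothesis list = the printed one with «`Λ`-cotorsion» read as
  «`Sel_{2^∞}(W/ℚ)` finite»); ★★ `natCard_kerG_zero_eq_seed'` (**`#ker g_0 = 2^{ord₂ Tam + 2·ord₂ #W̃(𝔽₂)}`**, datum-free, `s`-free); ★★ `natCard_selmerInvariants_zero_eq_mul_seed'`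
  (**`#Sel_{2^∞}(W/ℚ_∞)^Γ = 2^{ord₂ Tam + 2·ord₂ #W̃(𝔽₂)}·#Sel_{2^∞}(W/ℚ)`**); ★★★ `mu_eq_zero_iff_layer_seed'` (the EXACT one-layer door, `s`-free);
  ★★ `natCard_selmerLayer_succ_mul_kerG_eq_seed'` (the exact one-layer law, `s`-free).
Nothing numerical is asserted about any curve; C2 untouched. Memo `Cruxes/MainConjectureOfRankZeroBSDAtTwo/EULER-BRIDGE-att-p5-g61.md`.

References: R. Greenberg, LNM 1716 (1999), §3–§4, Prop. 4.14 [GreenbergLNM1716]; L. Washington, GTM 83, §13.3 [Washington1997].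
-/

set_option linter.dupNamespace false
set_option autoImplicit false

noncomputable section

open scoped Classical Polynomial

universe u

namespace Summit.BirchSwinnertonDyer.BirchSwinnertonDyer.Theorems.AlignedTransportAtTwoHalfDescentBaseIndexNoFiniteFree

open WeierstrassCurve Literature.NumberTheory.EllipticCurves Literature.NumberTheory.EllipticCurves.IwasawaAlgebra
  Literature.NumberTheory.EllipticCurves.Rank1Residual
  Summit.BirchSwinnertonDyer.Rank1Residual.X1.MuLambda
  Summit.BirchSwinnertonDyer.Rank1Residual.Iwasawa
  Summit.BirchSwinnertonDyer.BirchSwinnertonDyer.Theorems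
  Summit.BirchSwinnertonDyer.BirchSwinnertonDyer.Theorems.AlignedTransportAtTwoHalfDescentBaseIndexNoFinite
  Summit.BirchSwinnertonDyer.BirchSwinnertonDyer.Theorems.AlignedTransportAtTwoHalfDescentBaseIndexLayerNumbers

/-! ## §1 A finite `p^∞`-Selmer group has `p`-power order -/

section Selmer

/-- ★ **`#Sel_{p^∞}(W/F) = p^s` for some `s`** whenever `Sel_{p^∞}(W/F)` is finite — every Selmer class is killed by a power of `p` (tree `exists_pow_nsmul_eq_zero_selmerGroupPInfty`), so the
group is a finite `p`-group (Mathlib `IsPGroup.iff_card`). [folklore] -/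
theorem exists_natCard_selmerGroupPInfty_eq_pow {F : Type} [Field F] [NumberField F] (W : WeierstrassCurve F) (p : ℕ) [hp : Fact p.Prime]
    [Finite (W.selmerGroupPInfty p)] : ∃ s : ℕ, Nat.card (W.selmerGroupPInfty p) = p ^ s := by
  have hP : IsPGroup p (Multiplicative (W.selmerGroupPInfty p)) := by
    intro g
    obtain ⟨k, hk⟩ := exists_pow_nsmul_eq_zero_selmerGroupPInfty W p (Multiplicative.toAdd g)
    refine ⟨k, Multiplicative.toAdd.injective ?_⟩
    rw [toAdd_pow, toAdd_one]
    exact hk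
  obtain ⟨n, hn⟩ := IsPGroup.iff_card.mp hP
  exact ⟨n, by rw [← hn, Nat.card_eq_of_bijective Multiplicative.ofAdd Multiplicative.ofAdd.bijective]⟩

end Selmer

/-! ## §2 `ℚ`, good ordinary `p` with pure point count, `Sel_{p^∞}(W/ℚ)` finite -/

section Rat

variable (W : WeierstrassCurve ℚ) [W.IsElliptic] [W.IsGloballyMinimal] {p : ℕ} [hp : Fact p.Prime] (κ : ZpExtension ℚ p) {γ : Field.absoluteGaloisGroup ℚ}

/-- ★★★ **NO FINITE SUBMODULE** — `W/ℚ` globally minimal, good ORDINARY at `p` with `#W̃(𝔽_p) = p^k`, `W(ℚ)[p] = 0`, `κ` cyclotomic with generator `γ`, ANY dual datum, `Sel_{p^∞}(W/ℚ)` FINITE: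
every finite `Λ`-submodule of `X(W/ℚ_∞)` is `0` (file XIII with the exponent `s` supplied by §1). [cite: GreenbergLNM1716, Prop. 4.14–4.15] -/
theorem forall_finite_submodule_eq_bot_of_pure' (hgo : GoodOrd W p) (hκ : κ.IsCyclotomic) (hγ : κ.IsTopGenerator γ) (hK : ∀ P : W.toAffine.Point, p • P = 0 → P = 0)
    {k : ℕ} (hN : W.reductionPointCount p = p ^ k) (D : W.SelmerDualData κ γ) [Finite (W.selmerGroupPInfty p)] :
    ∀ N : Submodule (IwasawaAlgebra p) D.X, Finite N → N = ⊥ := by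
  obtain ⟨s, hs⟩ := exists_natCard_selmerGroupPInfty_eq_pow W p
  exact forall_finite_submodule_eq_bot_of_pure W κ hgo hκ hγ hK hN D hs

/-- ★★ **`#ker g_0 = p^{ord_p Tam(W) + 2k}`** (hypotheses of `forall_finite_submodule_eq_bot_of_pure'`; datum-free right side). [cite: GreenbergLNM1716, §3 Lemmas 3.3–3.5, §4 Thm. 4.1] -/
theorem natCard_kerG_zero_eq_pow_of_pure' (hgo : GoodOrd W p) (hκ : κ.IsCyclotomic) (hγ : κ.IsTopGenerator γ) (hK : ∀ P : W.toAffine.Point, p • P = 0 → P = 0)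
    {k : ℕ} (hN : W.reductionPointCount p = p ^ k) (D : W.SelmerDualData κ γ) [Finite (W.selmerGroupPInfty p)] :
    Nat.card (W.KerG κ 0) = p ^ (padicValNat p W.tamagawaProduct + 2 * k) := by
  obtain ⟨s, hs⟩ := exists_natCard_selmerGroupPInfty_eq_pow W p
  exact natCard_kerG_zero_eq_pow_of_pure W κ hgo hκ hγ hK hN D hs

/-- ★★ **`#Sel_{p^∞}(W/ℚ_∞)^Γ = p^{ord_p Tam(W) + 2k} · #Sel_{p^∞}(W/ℚ)`** (hypotheses of `forall_finite_submodule_eq_bot_of_pure'`). [cite: GreenbergLNM1716, §4 Thm. 4.1, Lemma 4.2] -/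
theorem natCard_selmerInvariants_zero_eq_mul_of_pure' (hgo : GoodOrd W p) (hκ : κ.IsCyclotomic) (hγ : κ.IsTopGenerator γ) (hK : ∀ P : W.toAffine.Point, p • P = 0 → P = 0)
    {k : ℕ} (hN : W.reductionPointCount p = p ^ k) (D : W.SelmerDualData κ γ) [Finite (W.selmerGroupPInfty p)] :
    Nat.card ↥(W.selmerInfty κ ⊓ W.layerInvariants κ 0) = p ^ (padicValNat p W.tamagawaProduct + 2 * k) * Nat.card (W.selmerGroupPInfty p) := by
  obtain ⟨s, hs⟩ := exists_natCard_selmerGroupPInfty_eq_pow W p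
  rw [natCard_selmerInvariants_zero_eq_pow_of_pure W κ hgo hκ hγ hK hN D hs, hs, pow_add]

end Rat

/-! ## §3 `p = 2`: the seed cell, `s`-free -/

section Two

variable (W : WeierstrassCurve ℚ) [W.IsElliptic] [W.IsGloballyMinimal] (κ₂ : ZpExtension ℚ 2) {γ : Field.absoluteGaloisGroup ℚ}

/-- ★★★ **NO FINITE SUBMODULE ON THE SEED CELL** — `W/ℚ` globally minimal, good ORDINARY at `2`, no rational `2`-torsion abscissa, the cyclotomic `ℤ₂`-extension with generator `γ`, ANY dual datum `D`,
`Sel_{2^∞}(W/ℚ)` FINITE: **every finite `Λ`-submodule of `X(W/ℚ_∞)` is `0`** — Greenberg's Prop. 4.14 / Hachimori–Matsuno Cor. (i) at `p = 2` on the rank-`0` good-ordinary locus, with the printed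
hypothesis list («`E(ℚ)[2] = 0`, `Sel` cotorsion») read as «no rational `2`-torsion, `Sel_{2^∞}(W/ℚ)` finite»; the tree's named fact `Greenberg1999.prop414_noFiniteSubmodule_of_not_dvd_torsionOrder`
restricted to this locus is a theorem. [cite: GreenbergLNM1716, Prop. 4.14–4.15 (pp. 124–125)] [cite: HachimoriMatsuno2000, Corollary (i)] -/
theorem forall_finite_submodule_eq_bot_seed' (hgo : GoodOrd W 2) (ht : ∀ x : ℚ, ¬ Greenberg1999.HasRationalTwoTorsionX W x) (hκ : κ₂.IsCyclotomic) (hγ : κ₂.IsTopGenerator γ)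
    (D : W.SelmerDualData κ₂ γ) [Finite (W.selmerGroupPInfty 2)] : ∀ N : Submodule (IwasawaAlgebra 2) D.X, Finite N → N = ⊥ := by
  obtain ⟨s, hs⟩ := exists_natCard_selmerGroupPInfty_eq_pow W 2
  exact forall_finite_submodule_eq_bot_seed W κ₂ hgo ht hκ hγ D hs

/-- ★★ **`#ker g_0(W) = 2^{ord₂ Tam(W) + 2·ord₂ #W̃(𝔽₂)}` on the seed cell** (same hypotheses; the number depends neither on `s` nor on the datum). [cite: GreenbergLNM1716, §3 Lemmas 3.3–3.5, §4 Thm. 4.1] -/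
theorem natCard_kerG_zero_eq_seed' (hgo : GoodOrd W 2) (ht : ∀ x : ℚ, ¬ Greenberg1999.HasRationalTwoTorsionX W x) (hκ : κ₂.IsCyclotomic) (hγ : κ₂.IsTopGenerator γ)
    (D : W.SelmerDualData κ₂ γ) [Finite (W.selmerGroupPInfty 2)] :
    Nat.card (W.KerG κ₂ 0) = 2 ^ (padicValNat 2 W.tamagawaProduct + 2 * padicValNat 2 (W.reductionPointCount 2)) := by
  obtain ⟨s, hs⟩ := exists_natCard_selmerGroupPInfty_eq_pow W 2
  exact natCard_kerG_zero_eq_seed W κ₂ hgo ht hκ hγ D hs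

/-- ★★ **`#Sel_{2^∞}(W/ℚ_∞)^Γ = 2^{ord₂ Tam(W) + 2·ord₂ #W̃(𝔽₂)} · #Sel_{2^∞}(W/ℚ)` on the seed cell** (same hypotheses) — the base term of the whole lineage for a seed, datum-free and exact.
[cite: GreenbergLNM1716, §4 Thm. 4.1, Lemma 4.2] -/
theorem natCard_selmerInvariants_zero_eq_mul_seed' (hgo : GoodOrd W 2) (ht : ∀ x : ℚ, ¬ Greenberg1999.HasRationalTwoTorsionX W x) (hκ : κ₂.IsCyclotomic) (hγ : κ₂.IsTopGenerator γ)
    (D : W.SelmerDualData κ₂ γ) [Finite (W.selmerGroupPInfty 2)] :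
    Nat.card ↥(W.selmerInfty κ₂ ⊓ W.layerInvariants κ₂ 0) = 2 ^ (padicValNat 2 W.tamagawaProduct + 2 * padicValNat 2 (W.reductionPointCount 2)) * Nat.card (W.selmerGroupPInfty 2) := by
  obtain ⟨s, hs⟩ := exists_natCard_selmerGroupPInfty_eq_pow W 2
  rw [natCard_selmerInvariants_zero_eq_seed W κ₂ hgo ht hκ hγ D hs, hs, pow_add]

/-- ★★ **THE EXACT ONE-LAYER LAW, `s`-free** (same hypotheses, rank-`0` tower, `λ₂ < 2ⁿ`): `#Sel_{2^∞}(W/ℚ_{n+1})·#ker g_{n+1} = 2^{2ⁿμ₂ + λ₂}·#Sel_{2^∞}(W/ℚ_n)·#ker g_n`.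
[cite: GreenbergLNM1716, Thm. 1.10, §4 Lemma 4.3, Prop. 4.14] [cite: Washington1997, §13.3 Thm. 13.13] -/
theorem natCard_selmerLayer_succ_mul_kerG_eq_seed' (hgo : GoodOrd W 2) (ht : ∀ x : ℚ, ¬ Greenberg1999.HasRationalTwoTorsionX W x) (hκ : κ₂.IsCyclotomic) (hγ : κ₂.IsTopGenerator γ)
    (D : W.SelmerDualData κ₂ γ) [Finite (W.selmerGroupPInfty 2)] (hpos : ∀ n, 0 < Nat.card ↥(W.selmerLayer κ₂ n) * Nat.card (W.KerG κ₂ n)) {n : ℕ} (hlam : D.lambda < 2 ^ n) :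
    Nat.card ↥(W.selmerLayer κ₂ (n + 1)) * Nat.card (W.KerG κ₂ (n + 1)) = 2 ^ (2 ^ n * D.mu + D.lambda) * (Nat.card ↥(W.selmerLayer κ₂ n) * Nat.card (W.KerG κ₂ n)) := by
  obtain ⟨s, hs⟩ := exists_natCard_selmerGroupPInfty_eq_pow W 2
  exact natCard_selmerLayer_succ_mul_kerG_eq_seed W κ₂ hgo ht hκ hγ D hs hpos hlam

/-- ★★★ **THE EXACT ONE-LAYER DOOR, `s`-free** (same hypotheses): for any `n` with `λ₂ < 2ⁿ`, **`μ₂ = 0 ⟺ #Sel_{2^∞}(W/ℚ_{n+1})·#ker g_{n+1} < 2^{2ⁿ}·#Sel_{2^∞}(W/ℚ_n)·#ker g_n`**.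
[cite: GreenbergLNM1716, Conj. 1.11, Thm. 1.10, §4 Lemma 4.3] [cite: Washington1997, §13.3 Thm. 13.13] -/
theorem mu_eq_zero_iff_layer_seed' (hgo : GoodOrd W 2) (ht : ∀ x : ℚ, ¬ Greenberg1999.HasRationalTwoTorsionX W x) (hκ : κ₂.IsCyclotomic) (hγ : κ₂.IsTopGenerator γ)
    (D : W.SelmerDualData κ₂ γ) [Finite (W.selmerGroupPInfty 2)] (hpos : ∀ n, 0 < Nat.card ↥(W.selmerLayer κ₂ n) * Nat.card (W.KerG κ₂ n)) {n : ℕ} (hlam : D.lambda < 2 ^ n) :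
    D.mu = 0 ↔ Nat.card ↥(W.selmerLayer κ₂ (n + 1)) * Nat.card (W.KerG κ₂ (n + 1)) < 2 ^ (2 ^ n) * (Nat.card ↥(W.selmerLayer κ₂ n) * Nat.card (W.KerG κ₂ n)) := by
  obtain ⟨s, hs⟩ := exists_natCard_selmerGroupPInfty_eq_pow W 2
  exact mu_eq_zero_iff_layer_seed W κ₂ hgo ht hκ hγ D hs hpos hlam

end Two

end Summit.BirchSwinnertonDyer.BirchSwinnertonDyer.Theorems.AlignedTransportAtTwoHalfDescentBaseIndexNoFiniteFree

end
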